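import Summits.BirchSwinnertonDyer.Rank1Residual.P2.CornerFTwoPrintInterface
import Summits.BirchSwinnertonDyer.Rank1Residual.WAll.TargetCMTwoSlices
import Summits.BirchSwinnertonDyer.Rank1Residual.X12.CMTwoTorsionAbsent
import Literature.NumberTheory.EllipticCurves.ComplexMultiplicationTwistIsogenyProofs
import Literature.NumberTheory.EllipticCurves.ComplexMultiplicationMaximalOrderProofs
import Literature.NumberTheory.EllipticCurves.ComplexMultiplicationShaKnappProofs
import Literature.NumberTheory.EllipticCurves.ComplexMultiplicationShaRubinRationalCMProofs
import Literature.NumberTheory.EllipticCurves.ComplexMultiplicationHasCMThirteenProofs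
import Literature.NumberTheory.EllipticCurves.BSDSelmerSmithNoRationalTwoTorsionCMProofs
import HarnessLib

/-!
# Leaf CornerF @ `p = 2` — THE MODEL ATLAS, file 1/2 (cell `bsd-print-cf2`, D-0131 (2) print tier,
# typer ty2): the three `2`-adic CM types of the leaf REDUCED TO EXPLICIT MODELS

HONEST FRAMING (cell `bsd-print-cf2`, HOME `run/shared/lean/pub/bsd-print-cf2/`, verbatim in every
file): the partition leaf is `CornerF W 2` — `W/ℚ` globally minimal elliptic WITH CM and
`ord_{s=1} L(E,s) = 1`, at the prime `2` (rung leaf `WAllCornerFTwo`, K7t row B14; `0` census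
cells; OPEN AS A CLASS). Route `PrintCf2` (planner, 2026-08-27) cuts it by the behaviour of `2` in
the CM field `K`: RAMIFIED (`K ∈ {ℚ(i), ℚ(√−2)}`; crux `RamifiedTwoRankOneOfFacts`, class
`WAllCornerFTwoRamified`), INERT (`K = ℚ(√−3)` and the five odd Heegner fields; crux
`InertTwoRankOneOfFacts`, classes `WAllCornerFTwoInertGood ∧ WAllCornerFTwoInertBad`), SPLIT-BAD
(`K = ℚ(√−7)`, `2 ∣ N`; crux `SplitBadTwoRankOneOfFacts`, class `WAllCornerFTwoSplitBad`); the
split-GOOD quadrant is Li–Tian–Yan–Zhu 2025 in the kernel. Every theorem print has on these classes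
is stated on EXPLICIT MODELS — `E_n : y² = x³ − n²x` (Tian 2014, Tian–Yuan–Zhang 2017, Li–Liu–Tian
2024, Monsky 1990), quadratic twists `E^{(d)}` of one optimal curve (Shu–Zhai 2021 at `36a1`,
Kriz–Li 2019 Thm. 1.12, Coates–Li–Tian–Zhai 2015 at `49a1`), cube-sum curves `y² = x³ − 432n²`
(Cai–Shu–Tian, Hu–Shu–Yin, Kezuka–Li). This file and its sibling `CornerFTwoModelClasses.lean` are
the fact-free GLUE between the two currencies: NO arithmetic fact, NO definition, NO named fact
(D-0026) — Silverman *AEC* X.5.4 (the twists of a given `j`) assembled from tree theorems.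

## Contents

* §0 Generic model glue (`Atlas.*`): orientation flip of "`W` is a `ℚ`-model of `V`", `j` and
  `HasCM` / `CMRamified` / `CMSplit` / `CMInert` along `C • V = W`, and the generic twist normal
  form `j(W) = j(E) ∉ {0, 1728} ⇒ ∃ d ∈ ℤ∖{0} square-free, ∃ C, C • E^{(d)} = W`
  (`exists_variableChange_eq_quadraticTwist_intCast_of_j_eq`, Silverman X.5 Cor. 5.4.1).
* §1 INTEGRAL normal forms at the two special `j`: `j = 1728 ⇒ C • (y² = x³ + Ax) = W`, `A ∈ ℤ∖{0}`
  (`Atlas.exists_smul_quartic_int_of_j_eq_1728`); `j = 0 ⇒ C • (y² = x³ + B) = W`, `B ∈ ℤ∖{0}`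
  (`Atlas.exists_smul_sextic_int_of_j_eq_zero`); and the RATIONAL-`2`-TORSION DICHOTOMY of the quartic
  family: `A = −n²·□` — then `W` is a model of a congruent-number curve `E_n`, `n` SQUARE-FREE, the
  domain of every printed `j = 1728` theorem — or `−A ∉ ℤ²` (one rational `2`-torsion point only;
  NOTHING in print at `2`) (`Atlas.quartic_dichotomy`).
* §2 THE ATLAS: for `W` elliptic with CM,
  `CMRamified W 2 ⇒` model of `E_n` (`n` square-free) ∨ of `y² = x³ + Ax` (`−A ∉ ℤ²`) ∨ of
  `⟨0,−6,0,1,0⟩^{(d)} = (y² = x³ − 6x² + x)^{(d)}` (`j = 287496`, Cremona class `32a`) ∨ of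
  `cm8^{(d)}`, `cm8 = (y² = x³ + 4x² + 2x)` (`j = 8000`, conductor `256`) (`ramifiedAtlas`);
  `CMInert W 2 ⇒` model of `y² = x³ + B` ∨ of a square-free twist of one of `⟨0,6,0,−3,0⟩`
  (`j = 54000`), `27a4 = ⟨0,0,1,−30,63⟩` (`j = −12288000`), `cm11 = 121b1`, `cm19 = 361a1`, `cm43`,
  `cm67`, `cm163` (`inertAtlas`); `CMSplit W 2 ⇒` square-free twist of `cm7 = 49a1` or of
  `⟨0,−42,0,−7,0⟩` (`j = 16581375`) (`splitAtlas`).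
  The converses (every model is in its type) and the three classes in model currency are in file 2/2.

References: [SilvermanAEC2009] X.5 Prop. 5.4, Cor. 5.4.1 (twists of a given `j`); [SilvermanATAEC1994]
App. A §3 (the thirteen CM `j` and their minimal models); [Cox2013] §5.B Prop. 5.16 / Cor. 5.17
(splitting of `2` in `K`); HOME/PLAN.md §0–§3 (route PrintCf2, items 20362/20363/20368);
`WAll/TargetCMTwoSlices.lean` (p4's slice names); `P2/CornerFTwoPrintInterface.lean` (ty2 g0: the
`E_n` / `C_p` companions and the fact-free transport); `X12/CMTwoTorsion*.lean` (the `2`-torsion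
tables by `j`, not restated).
-/

noncomputable section

open scoped Classical

open WeierstrassCurve Literature.NumberTheory.EllipticCurves
  Literature.NumberTheory.EllipticCurves.Rank1Residual

set_option autoImplicit false


namespace Summit.BirchSwinnertonDyer.Rank1Residual.P2.CornerFTwo

/-! ## §0 Generic model glue -/

namespace Atlas

variable {V W : WeierstrassCurve ℚ}

/-- The two orientations of "`W` is a `ℚ`-model of `V`" (`C ↦ C⁻¹`). [folklore] -/
theorem exists_smul_eq_comm :
    (∃ C : VariableChange ℚ, C • V = W) ↔ ∃ C : VariableChange ℚ, C • W = V := by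
  constructor
  · rintro ⟨C, hC⟩
    exact ⟨C⁻¹, by rw [← hC, inv_smul_smul]⟩
  · rintro ⟨C, hC⟩
    exact ⟨C⁻¹, by rw [← hC, inv_smul_smul]⟩

/-- `j` is a `ℚ`-isomorphism invariant: `C • V = W ⇒ j(W) = j(V)` (Mathlib `variableChange_j`).
[cite: SilvermanAEC2009, III.1 Prop. 1.4(b)] -/
theorem j_eq_of_smul_eq [V.IsElliptic] [W.IsElliptic] {C : VariableChange ℚ} (hC : C • V = W) :
    W.j = V.j := by
  subst hC
  exact variableChange_j V C

/-- `HasCM` along a `ℚ`-isomorphism. [cite: SilvermanAEC2009, App. C §11] -/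
theorem hasCM_iff_of_smul_eq [V.IsElliptic] [W.IsElliptic] {C : VariableChange ℚ}
    (hC : C • V = W) : W.HasCM ↔ V.HasCM :=
  hasCM_iff_of_j_eq (j_eq_of_smul_eq hC)

/-- `CMRamified · p` along a `ℚ`-isomorphism (it is read off `j`). [folklore] -/
theorem cmRamified_iff_of_smul_eq [V.IsElliptic] [W.IsElliptic] {C : VariableChange ℚ}
    (hC : C • V = W) (p : ℕ) : CMRamified W p ↔ CMRamified V p := by
  unfold CMRamified; rw [j_eq_of_smul_eq hC]

/-- `CMSplit · p` along a `ℚ`-isomorphism (it is read off `j`). [folklore] -/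
theorem cmSplit_iff_of_smul_eq [V.IsElliptic] [W.IsElliptic] {C : VariableChange ℚ}
    (hC : C • V = W) (p : ℕ) : CMSplit W p ↔ CMSplit V p := by
  unfold CMSplit; rw [j_eq_of_smul_eq hC]

/-- `CMInert · p` along a `ℚ`-isomorphism (it is read off `j`). [folklore] -/
theorem cmInert_iff_of_smul_eq [V.IsElliptic] [W.IsElliptic] {C : VariableChange ℚ}
    (hC : C • V = W) (p : ℕ) : CMInert W p ↔ CMInert V p := by
  unfold CMInert; rw [cmRamified_iff_of_smul_eq hC, cmSplit_iff_of_smul_eq hC]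

/-- **Twist normal form along `j ∉ {0, 1728}`** (Silverman X.5 Cor. 5.4.1, square-free integral
representative): if `j(W) = j(E)` with `j(E) ≠ 0, 1728`, then `W` is a `ℚ`-model of `E^{(d)}` for
a square-free integer `d ≠ 0`. Orientation `C • E^{(d)} = W` (the cell's membership convention).
[cite: SilvermanAEC2009, X.5 Prop. 5.4 and Cor. 5.4.1] -/
theorem exists_smul_twist_of_j_eq {E : WeierstrassCurve ℚ} [E.IsElliptic] [W.IsElliptic]
    (hj : W.j = E.j) (h0 : E.j ≠ 0) (h1728 : E.j ≠ 1728) :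
    ∃ d : ℤ, d ≠ 0 ∧ Squarefree d ∧
      ∃ C : VariableChange ℚ, C • E.quadraticTwist (d : ℚ) = W := by
  obtain ⟨d, hd0, hsq, C, hC⟩ := exists_variableChange_eq_quadraticTwist_intCast_of_j_eq hj h0 h1728
  exact ⟨d, hd0, hsq, C⁻¹, by rw [← hC, inv_smul_smul]⟩

/-- `j` of a model of a twist: `C • E^{(d)} = W`, `d ≠ 0` ⇒ `j(W) = j(E)`.
[cite: SilvermanAEC2009, X.5 Cor. 5.4] -/
theorem j_eq_of_smul_twist {E : WeierstrassCurve ℚ} [E.IsElliptic] [W.IsElliptic] {d : ℚ}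
    (hd : d ≠ 0) {C : VariableChange ℚ} (hC : C • E.quadraticTwist d = W) : W.j = E.j := by
  haveI := E.isElliptic_quadraticTwist hd
  rw [j_eq_of_smul_eq hC, j_quadraticTwist _ hd]

/-! ## §1 Integral normal forms at `j = 1728` and `j = 0`; the `2`-torsion dichotomy at `j = 1728` -/

/-- `y² = x³ + Ax` is elliptic for `A ≠ 0` (`Δ = −64A³`). [cite: SilvermanAEC2009, X.5 Prop. 5.4] -/
theorem isElliptic_quartic {A : ℚ} (hA : A ≠ 0) :
    (⟨0, 0, 0, A, 0⟩ : WeierstrassCurve ℚ).IsElliptic := by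
  rw [WeierstrassCurve.isElliptic_iff, isUnit_iff_ne_zero]
  have hΔ : (⟨0, 0, 0, A, 0⟩ : WeierstrassCurve ℚ).Δ = -(64 * A ^ 3) := by
    simp only [WeierstrassCurve.Δ, WeierstrassCurve.b₂, WeierstrassCurve.b₄, WeierstrassCurve.b₆,
      WeierstrassCurve.b₈]
    ring
  rw [hΔ, neg_ne_zero]
  exact mul_ne_zero (by norm_num) (pow_ne_zero 3 hA)

/- `y² = x³ + B` is elliptic for `B ≠ 0` (`Δ = −432B²`): the landed
`Literature.NumberTheory.EllipticCurves.isElliptic_of_j_zero_model` (not restated). -/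

/-- **`j = 1728` on every model of `y² = x³ + Ax`** (`A ≠ 0`). [cite: SilvermanAEC2009, X.5 Prop. 5.4] -/
theorem j_eq_1728_of_smul_quartic {A : ℚ} (hA : A ≠ 0) [W.IsElliptic] {C : VariableChange ℚ}
    (hC : C • (⟨0, 0, 0, A, 0⟩ : WeierstrassCurve ℚ) = W) : W.j = 1728 := by
  haveI := isElliptic_quartic hA
  rw [j_eq_of_smul_eq hC, j_eq_c₄_pow_div]
  have hΔ : (⟨0, 0, 0, A, 0⟩ : WeierstrassCurve ℚ).Δ = -(64 * A ^ 3) := by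
    simp only [WeierstrassCurve.Δ, WeierstrassCurve.b₂, WeierstrassCurve.b₄, WeierstrassCurve.b₆,
      WeierstrassCurve.b₈]
    ring
  have hc₄ : (⟨0, 0, 0, A, 0⟩ : WeierstrassCurve ℚ).c₄ = -(48 * A) := by
    simp only [WeierstrassCurve.c₄, WeierstrassCurve.b₂, WeierstrassCurve.b₄]
    ring
  rw [hΔ, hc₄]
  have hA3 : A ^ 3 ≠ 0 := pow_ne_zero 3 hA
  field_simp
  ring

/-- **`j = 0` on every model of `y² = x³ + B`** (`B ≠ 0`). [cite: SilvermanAEC2009, X.5 Prop. 5.4] -/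
theorem j_eq_zero_of_smul_sextic {B : ℚ} (hB : B ≠ 0) [W.IsElliptic] {C : VariableChange ℚ}
    (hC : C • (⟨0, 0, 0, 0, B⟩ : WeierstrassCurve ℚ) = W) : W.j = 0 := by
  haveI := isElliptic_of_j_zero_model hB
  rw [j_eq_of_smul_eq hC, j_eq_c₄_pow_div]
  have hc₄ : (⟨0, 0, 0, 0, B⟩ : WeierstrassCurve ℚ).c₄ = 0 := by
    simp only [WeierstrassCurve.c₄, WeierstrassCurve.b₂, WeierstrassCurve.b₄]
    ring
  rw [hc₄]
  simp

/-- **Integral quartic normal form at `j = 1728`.** Every elliptic `W/ℚ` with `j(W) = 1728` is a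
`ℚ`-model of `y² = x³ + Ax` for an INTEGER `A ≠ 0` (Silverman X.5.4 (ii) gives `A ∈ ℚˣ`,
`Rubin1987.exists_smul_eq_of_j_eq_1728`; rescaling by `u = den A` makes it integral: the class of `A`
in `ℚˣ/ℚˣ⁴` is what matters). [cite: SilvermanAEC2009, X.5 Prop. 5.4 (ii)] -/
theorem exists_smul_quartic_int_of_j_eq_1728 [W.IsElliptic] (hj : W.j = 1728) :
    ∃ A : ℤ, A ≠ 0 ∧
      ∃ C : VariableChange ℚ, C • (⟨0, 0, 0, (A : ℚ), 0⟩ : WeierstrassCurve ℚ) = W := by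
  obtain ⟨a, C, ha, hC⟩ := Rubin1987.exists_smul_eq_of_j_eq_1728 hj
  have hden : (a.den : ℚ) ≠ 0 := Nat.cast_ne_zero.mpr a.den_nz
  set D : VariableChange ℚ := ⟨Units.mk0 (a.den : ℚ) hden, 0, 0, 0⟩ with hD
  -- `den⁻⁴ · (num · den³) = num / den = a`
  have key : ((a.den : ℚ))⁻¹ ^ 4 * (((a.num * (a.den : ℤ) ^ 3 : ℤ)) : ℚ) = a := by
    have h := Rat.num_div_den a
    have e : (((a.num * (a.den : ℤ) ^ 3 : ℤ)) : ℚ) = (a.num : ℚ) * (a.den : ℚ) ^ 3 := by push_cast; ring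
    rw [e]
    calc ((a.den : ℚ))⁻¹ ^ 4 * ((a.num : ℚ) * (a.den : ℚ) ^ 3)
        = (a.num : ℚ) / (a.den : ℚ) := by field_simp
      _ = a := h
  have hDE : D • (⟨0, 0, 0, (((a.num * (a.den : ℤ) ^ 3 : ℤ)) : ℚ), 0⟩ : WeierstrassCurve ℚ) =
      ⟨0, 0, 0, a, 0⟩ := by
    ext
    · simp [hD, WeierstrassCurve.variableChange_a₁]
    · simp [hD, WeierstrassCurve.variableChange_a₂]
    · simp [hD, WeierstrassCurve.variableChange_a₃]
    · simp only [hD, WeierstrassCurve.variableChange_a₄, Units.val_inv_eq_inv_val, Units.val_mk0]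
      linear_combination key
    · simp [hD, WeierstrassCurve.variableChange_a₆]
  refine ⟨a.num * (a.den : ℤ) ^ 3, ?_, C⁻¹ * D, ?_⟩
  · exact mul_ne_zero (Rat.num_ne_zero.mpr ha) (pow_ne_zero 3 (by exact_mod_cast a.den_nz))
  · rw [mul_smul, hDE, ← hC, inv_smul_smul]

/-- **Integral sextic normal form at `j = 0`.** Every elliptic `W/ℚ` with `j(W) = 0` is a `ℚ`-model
of `y² = x³ + B` (`= mordellCurve B`) for an INTEGER `B ≠ 0` (Silverman X.5.4 (iii),
`Rubin1987.exists_smul_eq_of_j_eq_zero`, then `u = den B`; the class of `B` in `ℚˣ/ℚˣ⁶` is what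
matters). The cube-sum curve `x³ + y³ = n` is `B = −432n²`. [cite: SilvermanAEC2009, X.5 Prop. 5.4 (iii)] -/
theorem exists_smul_sextic_int_of_j_eq_zero [W.IsElliptic] (hj : W.j = 0) :
    ∃ B : ℤ, B ≠ 0 ∧
      ∃ C : VariableChange ℚ, C • (⟨0, 0, 0, 0, (B : ℚ)⟩ : WeierstrassCurve ℚ) = W := by
  obtain ⟨b, C, hb, hC⟩ := Rubin1987.exists_smul_eq_of_j_eq_zero hj
  have hden : (b.den : ℚ) ≠ 0 := Nat.cast_ne_zero.mpr b.den_nz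
  set D : VariableChange ℚ := ⟨Units.mk0 (b.den : ℚ) hden, 0, 0, 0⟩ with hD
  -- `den⁻⁶ · (num · den⁵) = num / den = b`
  have key : ((b.den : ℚ))⁻¹ ^ 6 * (((b.num * (b.den : ℤ) ^ 5 : ℤ)) : ℚ) = b := by
    have h := Rat.num_div_den b
    have e : (((b.num * (b.den : ℤ) ^ 5 : ℤ)) : ℚ) = (b.num : ℚ) * (b.den : ℚ) ^ 5 := by push_cast; ring
    rw [e]
    calc ((b.den : ℚ))⁻¹ ^ 6 * ((b.num : ℚ) * (b.den : ℚ) ^ 5)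
        = (b.num : ℚ) / (b.den : ℚ) := by field_simp
      _ = b := h
  have hDE : D • (⟨0, 0, 0, 0, (((b.num * (b.den : ℤ) ^ 5 : ℤ)) : ℚ)⟩ : WeierstrassCurve ℚ) =
      ⟨0, 0, 0, 0, b⟩ := by
    ext
    · simp [hD, WeierstrassCurve.variableChange_a₁]
    · simp [hD, WeierstrassCurve.variableChange_a₂]
    · simp [hD, WeierstrassCurve.variableChange_a₃]
    · simp [hD, WeierstrassCurve.variableChange_a₄]
    · simp only [hD, WeierstrassCurve.variableChange_a₆, Units.val_inv_eq_inv_val, Units.val_mk0]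
      linear_combination key
  refine ⟨b.num * (b.den : ℤ) ^ 5, ?_, C⁻¹ * D, ?_⟩
  · exact mul_ne_zero (Rat.num_ne_zero.mpr hb) (pow_ne_zero 5 (by exact_mod_cast b.den_nz))
  · rw [mul_smul, hDE, ← hC, inv_smul_smul]

/-- **The rational-`2`-torsion dichotomy of the quartic family.** A model `W` of `y² = x³ + Ax`
(`A ∈ ℤ∖{0}`) either is a model of a congruent-number curve `E_n = (y² = x³ − n²x)` with `n`
SQUARE-FREE — exactly when `−A` is a square, i.e. the full `2`-torsion is rational; this is the
domain of every printed `j = 1728` theorem at `2` (Tian 2014, Tian–Yuan–Zhang 2017, Li–Liu–Tian 2024,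
Monsky 1990; ty2 g0 `CongruentNumber.exists_smul_congruentNumberCurve_of_smul_eq_neg_sq`) — or has
`−A ∉ ℤ²` (one rational point of order `2` only; no theorem in print at `2`).
[cite: SilvermanAEC2009, X.5 Prop. 5.4 (ii) and X.6 Prop. 6.1] -/
theorem quartic_dichotomy {A : ℤ} (hA : A ≠ 0)
    (hW : ∃ C : VariableChange ℚ, C • (⟨0, 0, 0, (A : ℚ), 0⟩ : WeierstrassCurve ℚ) = W) :
    (∃ n : ℕ, Squarefree n ∧ ∃ C : VariableChange ℚ, C • congruentNumberCurve n = W) ∨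
      ¬ IsSquare (-A) := by
  by_cases hsq : IsSquare (-A)
  · left
    obtain ⟨m, hm⟩ := hsq
    have hm0 : (m : ℚ) ≠ 0 := by
      have : m ≠ 0 := by
        rintro rfl
        simp at hm
        exact hA hm
      exact_mod_cast this
    have hAm : ((A : ℚ)) = -(m : ℚ) ^ 2 := by
      have : A = -(m * m) := by omega
      rw [this]; push_cast; ring
    obtain ⟨C, hC⟩ := exists_smul_eq_comm.1 hW
    rw [hAm] at hC
    exact CongruentNumber.exists_smul_congruentNumberCurve_of_smul_eq_neg_sq hm0 hC
  · exact Or.inr hsq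

end Atlas

open Atlas

/-! ## §2 The atlas: the three `2`-adic CM types as explicit model families -/

section AtlasTheorems

variable {W : WeierstrassCurve ℚ} [W.IsElliptic]

/-- **RAMIFIED TYPE, model atlas.** An elliptic `W/ℚ` with CM and `2` ramified in `K`
(`K ∈ {ℚ(i), ℚ(√−2)}`, `j ∈ {1728, 287496, 8000}`) is a `ℚ`-model of exactly one of:
(a) a congruent-number curve `E_n`, `n` square-free (`j = 1728`, full rational `2`-torsion);
(b) `y² = x³ + Ax`, `A ∈ ℤ∖{0}`, `−A ∉ ℤ²` (`j = 1728`, one rational `2`-torsion point);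
(c) a square-free quadratic twist of `⟨0,−6,0,1,0⟩ = (y² = x³ − 6x² + x)` (`j = 287496 = 66³`, order
`ℤ[2i]`, Cremona class `32a`); (d) a square-free quadratic twist of `cm8 = (y² = x³ + 4x² + 2x)`
(`j = 8000 = 20³`, `K = ℚ(√−2)`, conductor `256`).
[cite: SilvermanAEC2009, X.5 Prop. 5.4 and Cor. 5.4.1] [cite: SilvermanATAEC1994, App. A §3] -/
theorem ramifiedAtlas (hcm : W.HasCM) (hram : CMRamified W 2) :
    (∃ n : ℕ, Squarefree n ∧ ∃ C : VariableChange ℚ, C • congruentNumberCurve n = W) ∨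
    (∃ A : ℤ, A ≠ 0 ∧ ¬ IsSquare (-A) ∧
      ∃ C : VariableChange ℚ, C • (⟨0, 0, 0, (A : ℚ), 0⟩ : WeierstrassCurve ℚ) = W) ∨
    (∃ d : ℤ, d ≠ 0 ∧ Squarefree d ∧ ∃ C : VariableChange ℚ,
      C • (⟨0, -6, 0, 1, 0⟩ : WeierstrassCurve ℚ).quadraticTwist (d : ℚ) = W) ∨
    (∃ d : ℤ, d ≠ 0 ∧ Squarefree d ∧ ∃ C : VariableChange ℚ,
      C • cm8.quadraticTwist (d : ℚ) = W) := by
  rcases (cmRamified_two_iff_of_hasCM hcm).1 hram with h4 | h8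
  · rcases X12.j_eq_of_cmFieldDiscrOfJ_eq_neg_four h4 with hj | hj
    · obtain ⟨A, hA, hWA⟩ := exists_smul_quartic_int_of_j_eq_1728 hj
      rcases quartic_dichotomy hA hWA with h | h
      · exact Or.inl h
      · exact Or.inr (Or.inl ⟨A, hA, h, hWA⟩)
    · exact Or.inr (Or.inr (Or.inl (exists_smul_twist_of_j_eq (by rw [hj, j_cm16])
        (by rw [j_cm16]; norm_num) (by rw [j_cm16]; norm_num))))
  · exact Or.inr (Or.inr (Or.inr (exists_smul_twist_of_j_eq
      (by rw [X12.j_eq_of_cmFieldDiscrOfJ_eq_neg_eight h8, j_cm8])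
      (by rw [j_cm8]; norm_num) (by rw [j_cm8]; norm_num))))

/-- **INERT TYPE, model atlas.** An elliptic `W/ℚ` with CM and `2` inert in `K`
(`d_K ∈ {−3, −11, −19, −43, −67, −163}`) is a `ℚ`-model of one of:
(a) `y² = x³ + B`, `B ∈ ℤ∖{0}` (`j = 0`; the cube-sum curves are `B = −432n²`, the `36a1`-twists are
`B = c³`); (b) a square-free twist of `⟨0,6,0,−3,0⟩ = (y² = x³ + 6x² − 3x)` (`j = 54000`, order
`ℤ[√−3]`, a rational `2`-torsion point); (c) of `27a4 = ⟨0,0,1,−30,63⟩` (`j = −12288000`, order of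
conductor `3`, `E(ℚ)[2] = 0`); (d)–(h) of `cm11 = 121b1`, `cm19 = 361a1`, `cm43 = 1849a1`,
`cm67 = 4489a1`, `cm163 = 26569a1` (the five odd Heegner fields, `E(ℚ)[2] = 0`).
[cite: SilvermanAEC2009, X.5 Prop. 5.4 and Cor. 5.4.1] [cite: SilvermanATAEC1994, App. A §3] -/
theorem inertAtlas (hcm : W.HasCM) (hin : CMInert W 2) :
    (∃ B : ℤ, B ≠ 0 ∧
      ∃ C : VariableChange ℚ, C • (⟨0, 0, 0, 0, (B : ℚ)⟩ : WeierstrassCurve ℚ) = W) ∨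
    (∃ d : ℤ, d ≠ 0 ∧ Squarefree d ∧ ∃ C : VariableChange ℚ,
      C • (⟨0, 6, 0, -3, 0⟩ : WeierstrassCurve ℚ).quadraticTwist (d : ℚ) = W) ∨
    (∃ d : ℤ, d ≠ 0 ∧ Squarefree d ∧ ∃ C : VariableChange ℚ,
      C • (⟨0, 0, 1, -30, 63⟩ : WeierstrassCurve ℚ).quadraticTwist (d : ℚ) = W) ∨
    (∃ d : ℤ, d ≠ 0 ∧ Squarefree d ∧ ∃ C : VariableChange ℚ,
      C • cm11.quadraticTwist (d : ℚ) = W) ∨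
    (∃ d : ℤ, d ≠ 0 ∧ Squarefree d ∧ ∃ C : VariableChange ℚ,
      C • cm19.quadraticTwist (d : ℚ) = W) ∨
    (∃ d : ℤ, d ≠ 0 ∧ Squarefree d ∧ ∃ C : VariableChange ℚ,
      C • cm43.quadraticTwist (d : ℚ) = W) ∨
    (∃ d : ℤ, d ≠ 0 ∧ Squarefree d ∧ ∃ C : VariableChange ℚ,
      C • cm67.quadraticTwist (d : ℚ) = W) ∨
    (∃ d : ℤ, d ≠ 0 ∧ Squarefree d ∧ ∃ C : VariableChange ℚ,
      C • cm163.quadraticTwist (d : ℚ) = W) := by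
  haveI := isElliptic_curve27a4
  rcases (cmInert_two_iff_of_hasCM hcm).1 hin with h | h | h | h | h | h
  · rcases X12.j_eq_of_cmFieldDiscrOfJ_eq_neg_three h with hj | hj | hj
    · exact Or.inl (exists_smul_sextic_int_of_j_eq_zero hj)
    · exact Or.inr (Or.inl (exists_smul_twist_of_j_eq (by rw [hj, j_cm12])
        (by rw [j_cm12]; norm_num) (by rw [j_cm12]; norm_num)))
    · exact Or.inr (Or.inr (Or.inl (exists_smul_twist_of_j_eq (by rw [hj, j_curve27a4])
        (by rw [j_curve27a4]; norm_num) (by rw [j_curve27a4]; norm_num))))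
  · exact Or.inr (Or.inr (Or.inr (Or.inl (exists_smul_twist_of_j_eq
      (by rw [X12.j_eq_of_cmFieldDiscrOfJ_eq_neg_eleven h, j_cm11])
      (by rw [j_cm11]; norm_num) (by rw [j_cm11]; norm_num)))))
  · exact Or.inr (Or.inr (Or.inr (Or.inr (Or.inl (exists_smul_twist_of_j_eq
      (by rw [X12.j_eq_of_cmFieldDiscrOfJ_eq_neg_nineteen h, j_cm19])
      (by rw [j_cm19]; norm_num) (by rw [j_cm19]; norm_num))))))
  · exact Or.inr (Or.inr (Or.inr (Or.inr (Or.inr (Or.inl (exists_smul_twist_of_j_eq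
      (by rw [X12.j_eq_of_cmFieldDiscrOfJ_eq_neg_fortythree h, j_cm43])
      (by rw [j_cm43]; norm_num) (by rw [j_cm43]; norm_num)))))))
  · exact Or.inr (Or.inr (Or.inr (Or.inr (Or.inr (Or.inr (Or.inl (exists_smul_twist_of_j_eq
      (by rw [X12.j_eq_of_cmFieldDiscrOfJ_eq_neg_sixtyseven h, j_cm67])
      (by rw [j_cm67]; norm_num) (by rw [j_cm67]; norm_num))))))))
  · exact Or.inr (Or.inr (Or.inr (Or.inr (Or.inr (Or.inr (Or.inr (exists_smul_twist_of_j_eq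
      (by rw [X12.j_eq_of_cmFieldDiscrOfJ_eq_neg_onesixtythree h, j_cm163])
      (by rw [j_cm163]; norm_num) (by rw [j_cm163]; norm_num))))))))

/-- **SPLIT TYPE, model atlas.** An elliptic `W/ℚ` with CM and `2` split in `K` (`K = ℚ(√−7)`,
`j ∈ {−3375, 16581375}`) is a `ℚ`-model of a square-free quadratic twist of `cm7 = 49a1 =
⟨1,−1,0,−2,−1⟩` or of `⟨0,−42,0,−7,0⟩` (`j = 16581375 = 255³`, order `ℤ[√−7]`; e.g. `49a2` up to a
twist). For the split-BAD class add `¬ Good W 2`, i.e. `d ≢ 1 (mod 4)` on the `49a1` side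
(`exists_squarefree_twist_of_j_neg3375_of_not_good_two`, route GoldfeldAllTwistsTwoConverse, not
restated). [cite: SilvermanAEC2009, X.5 Prop. 5.4 and Cor. 5.4.1] [cite: SilvermanATAEC1994, App. A §3] -/
theorem splitAtlas (hsp : CMSplit W 2) :
    (∃ d : ℤ, d ≠ 0 ∧ Squarefree d ∧ ∃ C : VariableChange ℚ,
      C • cm7.quadraticTwist (d : ℚ) = W) ∨
    (∃ d : ℤ, d ≠ 0 ∧ Squarefree d ∧ ∃ C : VariableChange ℚ,
      C • (⟨0, -42, 0, -7, 0⟩ : WeierstrassCurve ℚ).quadraticTwist (d : ℚ) = W) := by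
  rcases X12.j_eq_of_cmFieldDiscrOfJ_eq_neg_seven
      (BurungaleCastellaSkinnerTian2022.cmFieldDiscrOfJ_eq_of_cmSplit_two W hsp) with hj | hj
  · exact Or.inl (exists_smul_twist_of_j_eq (by rw [hj, j_cm7])
      (by rw [j_cm7]; norm_num) (by rw [j_cm7]; norm_num))
  · exact Or.inr (exists_smul_twist_of_j_eq (by rw [hj, j_cm28])
      (by rw [j_cm28]; norm_num) (by rw [j_cm28]; norm_num))

end AtlasTheorems

end Summit.BirchSwinnertonDyer.Rank1Residual.P2.CornerFTwo

end
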